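import Summits.AnomalousDissipation.AnomalousDissipation.Theorems.MomentParityPathField
import Summits.AnomalousDissipation.AnomalousDissipation.Theorems.MomentParityCoupling
import Literature.Analysis.FluidPDE.DoeringFoiasProofs
import Mathlib.Dynamics.BirkhoffSum.Average

/-! # Crux `EnsembleRealization` (stmt-AnomalousDissipation-0215) — line `augmented-lift`,
  stub `stub_pathwiseCoupling`: the pathwise Doering–Foias coupling of a realised path

Let `ω` be a path of MomentParity's trajectory space `𝒦 = pathSpace R L` (`MomentParityDefs`)
which, after a time shift `s ≥ 0`, is REALISED by a global Leray–Hopf solution `u` with datum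
`u 0` and steady force `f`: `𝓕(u t)(k) = ω̄(s + t, k)` for `t ≥ 0`.  Then for every window `[0, b]`,
`b ≥ 0`,
`∫₀ᵇ pathDiss ν K ω ≤ s·ν4π²K²R² + ½‖u 0‖₂² + ‖f‖₂ √b (∫₀ᵇ pathEnergyTot ω)^{1/2}`:
on `[0, s]` the resolved dissipation is bounded by `ν4π²K²R²` (`pathDiss_le`); on `[s, b]` one
substitutes `t = s + τ`, compares the resolved dissipation of the path with the dissipation
`ν‖∇u(τ)‖₂²` of the field at the a.e. times where the latter is finite
(`pathDiss_le_mul_toReal_eGradNormSq`, `IsLerayHopfOn.lintegral_eGradNormSq_lt_top`), uses the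
Leray–Hopf energy inequality from `0` (`Torus.IsLerayHopfOn.intervalIntegral_dissipation_le`),
Cauchy–Schwarz in space `|∫⟪f, u τ⟫| ≤ ‖f‖₂ (pathEnergyTot ω (s + τ))^{1/2}`
(`abs_integral_inner_le_of_coef`) and Cauchy–Schwarz in time (`integral_sqrt_le`).  In Birkhoff
form along the unit shift `θ` of `𝒦` (`birkhoffSum_dissMean`, `birkhoffSum_energyMean`) this is the
coupling `A_n F_d(ω) ≤ c₀/n + ‖f‖₂ (A_n F_e(ω))^{1/2}`, `n ≥ 1`, fed to the Birkhoff–Chebyshev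
selection (Doering–Foias 2002 §2 bookkeeping; the sibling `MomentParityCoupling` proves the same
inequality along limits of Galerkin orbits).
-/

noncomputable section

-- every `Summit.AnomalousDissipation.AnomalousDissipation.…` name repeats the summit = sub-problem segment (D-0017 layout)
set_option linter.dupNamespace false

open MeasureTheory Set Filter Topology Function Metric UnitAddTorus
open scoped BigOperators ENNReal InnerProductSpace RealInnerProductSpace

namespace Summit.AnomalousDissipation.AnomalousDissipation.Theorems.EnsembleRealization

open Literature.Analysis.FunctionSpaces Literature.Analysis.FunctionSpaces.Torus
open Literature.Analysis.FluidPDE Literature.Analysis.FluidPDE.Torus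
open Summit.AnomalousDissipation.AnomalousDissipation.Theorems.MomentParity

variable {ν : ℝ} {f : UnitAddTorus (Fin 3) → EuclideanSpace ℝ (Fin 3)}

/-- **Resolved dissipation of a realised path vs. dissipation of the field, integrated.** If `u` is
Leray–Hopf on `[0, T)`, `T > 0`, `ν ≥ 0`, and `𝓕(u t) = ω̄(s + t, ·)` for `t ≥ 0`, then
`∫₀ᵀ pathDiss ν K ω (s + τ) dτ ≤ ∫₀ᵀ ν ‖∇u(τ)‖₂² dτ`. -/
private theorem intervalIntegral_pathDiss_comp_add_le (hν : 0 ≤ ν) {ω : Path (Fin 3)} {s : ℝ}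
    {u₀ : UnitAddTorus (Fin 3) → EuclideanSpace ℝ (Fin 3)}
    {u : ℝ → UnitAddTorus (Fin 3) → EuclideanSpace ℝ (Fin 3)} {T : ℝ} (hT : 0 < T)
    (hLH : IsLerayHopfOn T ν (fun _ => f) u₀ u)
    (hcoef : ∀ t, 0 ≤ t → ∀ k, mFourierCoeff (EuclideanSpace.complexify ∘ u t) k = pathExt ω (s + t) k)
    (K : ℕ) :
    ∫ τ in (0 : ℝ)..T, pathDiss ν K ω (s + τ) ≤
      ∫ τ in (0 : ℝ)..T, ν * (eGradNormSq (u τ)).toReal := by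
  -- adapted from MomentParity.timeMean_pathDiss_comp_add_le (StubTimeAverages)
  have hmeas := hLH.aemeasurable_eGradNormSq
  have hfin := hLH.lintegral_eGradNormSq_lt_top
  have hlt : ∀ᵐ τ ∂(volume.restrict (Ioo 0 T)), eGradNormSq (u τ) < ⊤ := ae_lt_top' hmeas hfin.ne
  rw [intervalIntegral.integral_of_le hT.le, intervalIntegral.integral_of_le hT.le,
    integral_Ioc_eq_integral_Ioo, integral_Ioc_eq_integral_Ioo]
  refine integral_mono_of_nonneg (ae_of_all _ fun t => pathDiss_nonneg hν K ω (s + t))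
    ((integrable_toReal_of_lintegral_ne_top hmeas hfin.ne).const_mul ν) ?_
  filter_upwards [hlt, ae_restrict_mem measurableSet_Ioo] with t ht hmem
  exact pathDiss_le_mul_toReal_eGradNormSq hν K (hcoef t hmem.1.le) ht.ne

/-- **The pathwise Doering–Foias coupling on a window.** If a global Leray–Hopf solution `u`
(datum `u 0`, steady smooth mean-zero force `f`, `ν > 0`) realises the path `ω ∈ 𝒦` after the
shift `s ≥ 0`, then for every `b ≥ 0`,
`∫₀ᵇ pathDiss ν K ω ≤ s·ν4π²K²R² + kineticEnergy (u 0) + ‖f‖₂ √b (∫₀ᵇ pathEnergyTot ω)^{1/2}`. -/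
private theorem intervalIntegral_pathDiss_le_pathwise (hν : 0 < ν) (hf : IsSmooth f)
    (hf0 : HasZeroMean f) {R : ℝ} {L : (Fin 3 → ℤ) → ℝ} {ω : Path (Fin 3)}
    (hω : ω ∈ pathSpace R L) {s : ℝ} (hs : 0 ≤ s)
    {u : ℝ → UnitAddTorus (Fin 3) → EuclideanSpace ℝ (Fin 3)}
    (hu : IsGlobalLerayHopf ν (fun _ => f) (u 0) u)
    (hcoef : ∀ t, 0 ≤ t → MemLp (u t) 2 volume ∧
      ∀ k, mFourierCoeff (EuclideanSpace.complexify ∘ u t) k = pathExt ω (s + t) k)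
    (K : ℕ) {b : ℝ} (hb : 0 ≤ b) :
    ∫ t in (0 : ℝ)..b, pathDiss ν K ω t ≤
      s * (ν * (4 * Real.pi ^ 2 * ((K : ℝ) ^ 2 * R ^ 2))) + kineticEnergy (u 0) +
        Real.sqrt (∫ x, ‖f x‖ ^ 2) *
          (Real.sqrt b * Real.sqrt (∫ t in (0 : ℝ)..b, pathEnergyTot ω t)) := by
  -- adapted from MomentParityCoupling (`intervalIntegral_pathDiss_le_of_tendsto`)
  have hA'0 : 0 ≤ Real.sqrt (∫ x, ‖f x‖ ^ 2) := Real.sqrt_nonneg _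
  have hB0 : 0 ≤ ν * (4 * Real.pi ^ 2 * ((K : ℝ) ^ 2 * R ^ 2)) :=
    (pathDiss_nonneg hν.le K ω 0).trans (pathDiss_le hν.le K hω 0)
  have hkin : 0 ≤ kineticEnergy (u 0) := kineticEnergy_nonneg _
  have hlast : 0 ≤ Real.sqrt (∫ x, ‖f x‖ ^ 2) *
      (Real.sqrt b * Real.sqrt (∫ t in (0 : ℝ)..b, pathEnergyTot ω t)) := by positivity
  -- the resolved dissipation over a window `[0, c]` is at most `c · ν4π²K²R²`
  have hwin : ∀ c : ℝ, 0 ≤ c →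
      ∫ t in (0 : ℝ)..c, pathDiss ν K ω t ≤ c * (ν * (4 * Real.pi ^ 2 * ((K : ℝ) ^ 2 * R ^ 2))) := by
    intro c hc
    have h := intervalIntegral.integral_mono_on hc (intervalIntegrable_pathDiss hω ν K 0 c)
      intervalIntegrable_const fun t _ => pathDiss_le hν.le K hω t
    rwa [intervalIntegral.integral_const, sub_zero, smul_eq_mul] at h
  rcases le_or_gt b s with hbs | hsb
  · -- short windows: everything goes into the constant
    have h1 : ∫ t in (0 : ℝ)..b, pathDiss ν K ω t ≤ s * (ν * (4 * Real.pi ^ 2 * ((K : ℝ) ^ 2 * R ^ 2))) :=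
      (hwin b hb).trans (mul_le_mul_of_nonneg_right hbs hB0)
    linarith
  -- long windows: split `[0, b]` at `s` and work on `[s, b] = s + [0, b - s]`
  have hT : 0 < b - s := sub_pos.2 hsb
  have hLH : IsLerayHopfOn (b - s) ν (fun _ => f) (u 0) u := hu (b - s) hT
  have hsplit : ∫ t in (0 : ℝ)..b, pathDiss ν K ω t =
      (∫ t in (0 : ℝ)..s, pathDiss ν K ω t) + ∫ t in s..b, pathDiss ν K ω t :=
    (intervalIntegral.integral_add_adjacent_intervals (intervalIntegrable_pathDiss hω ν K 0 s)
      (intervalIntegrable_pathDiss hω ν K s b)).symm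
  have hshift : ∫ τ in (0 : ℝ)..(b - s), pathDiss ν K ω (s + τ) = ∫ t in s..b, pathDiss ν K ω t := by
    rw [intervalIntegral.integral_comp_add_left (fun t => pathDiss ν K ω t) s, add_zero,
      add_sub_cancel]
  -- (i) resolved dissipation of the path vs. dissipation of the field
  have hD1 : ∫ τ in (0 : ℝ)..(b - s), pathDiss ν K ω (s + τ) ≤
      ∫ τ in (0 : ℝ)..(b - s), ν * (eGradNormSq (u τ)).toReal :=
    intervalIntegral_pathDiss_comp_add_le hν.le hT hLH (fun t ht => (hcoef t ht).2) K
  -- (ii) the Leray–Hopf energy inequality from `0` on `[0, b - s]`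
  have hD2 : ∫ τ in (0 : ℝ)..(b - s), ν * (eGradNormSq (u τ)).toReal ≤
      kineticEnergy (u 0) + ∫ τ in (0 : ℝ)..(b - s), ∫ x, ⟪f x, u τ x⟫_ℝ :=
    hLH.intervalIntegral_dissipation_le hT
  -- (iii) Cauchy–Schwarz in space: the power is at most `‖f‖₂ √(pathEnergyTot ω (s + τ))`
  have hsqrt_meas : Measurable fun t => Real.sqrt (pathEnergyTot ω t) :=
    (measurable_pathEnergyTot_time hω).sqrt
  have hsqrt_int : ∀ a c : ℝ,
      IntervalIntegrable (fun t => Real.sqrt (pathEnergyTot ω t)) volume a c := by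
    intro a c
    refine (intervalIntegrable_const (c := |R|)).mono_fun hsqrt_meas.aestronglyMeasurable ?_
    refine ae_of_all _ fun t => ?_
    simp only [Real.norm_eq_abs, abs_of_nonneg (Real.sqrt_nonneg _), abs_abs]
    rw [← Real.sqrt_sq_eq_abs]
    exact Real.sqrt_le_sqrt (pathEnergyTot_le hω t)
  have hsqrt_int' : ∀ a c : ℝ,
      IntervalIntegrable (fun τ => Real.sqrt (pathEnergyTot ω (s + τ))) volume a c := by
    intro a c
    refine (intervalIntegrable_const (c := |R|)).mono_fun
      ((hsqrt_meas.comp (measurable_id.const_add s)).aestronglyMeasurable) ?_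
    refine ae_of_all _ fun τ => ?_
    simp only [Real.norm_eq_abs, abs_of_nonneg (Real.sqrt_nonneg _), abs_abs]
    rw [← Real.sqrt_sq_eq_abs]
    exact Real.sqrt_le_sqrt (pathEnergyTot_le hω (s + τ))
  have hP : ∫ τ in (0 : ℝ)..(b - s), ∫ x, ⟪f x, u τ x⟫_ℝ ≤
      Real.sqrt (∫ x, ‖f x‖ ^ 2) * ∫ τ in (0 : ℝ)..(b - s), Real.sqrt (pathEnergyTot ω (s + τ)) := by
    rw [← intervalIntegral.integral_const_mul]
    refine intervalIntegral.integral_mono_on hT.le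
      (hLH.intervalIntegrable_power hT hν (hf.memLp 2) hf0) ((hsqrt_int' 0 (b - s)).const_mul _)
      fun τ hτ => ?_
    exact (le_abs_self _).trans
      (abs_integral_inner_le_of_coef (hcoef τ hτ.1).1 (hcoef τ hτ.1).2 (hf.memLp 2))
  -- (iv) back to the window `[0, b]` and Cauchy–Schwarz in time
  have hback : ∫ τ in (0 : ℝ)..(b - s), Real.sqrt (pathEnergyTot ω (s + τ)) ≤
      ∫ t in (0 : ℝ)..b, Real.sqrt (pathEnergyTot ω t) := by
    rw [intervalIntegral.integral_comp_add_left (fun t => Real.sqrt (pathEnergyTot ω t)) s,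
      add_zero, add_sub_cancel,
      ← intervalIntegral.integral_add_adjacent_intervals (hsqrt_int 0 s) (hsqrt_int s b)]
    have h0 : 0 ≤ ∫ t in (0 : ℝ)..s, Real.sqrt (pathEnergyTot ω t) :=
      intervalIntegral.integral_nonneg hs fun t _ => Real.sqrt_nonneg _
    linarith
  have hCS := integral_sqrt_le hb (fun t => pathEnergyTot_nonneg ω t)
    (intervalIntegrable_pathEnergyTot hω 0 b) (hsqrt_int 0 b)
  have h0s := hwin s hs
  calc ∫ t in (0 : ℝ)..b, pathDiss ν K ω t
      = (∫ t in (0 : ℝ)..s, pathDiss ν K ω t) + ∫ τ in (0 : ℝ)..(b - s), pathDiss ν K ω (s + τ) := by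
        rw [hsplit, hshift]
    _ ≤ s * (ν * (4 * Real.pi ^ 2 * ((K : ℝ) ^ 2 * R ^ 2))) + (kineticEnergy (u 0) +
          Real.sqrt (∫ x, ‖f x‖ ^ 2) *
            ∫ τ in (0 : ℝ)..(b - s), Real.sqrt (pathEnergyTot ω (s + τ))) := by
        linarith
    _ ≤ s * (ν * (4 * Real.pi ^ 2 * ((K : ℝ) ^ 2 * R ^ 2))) + (kineticEnergy (u 0) +
          Real.sqrt (∫ x, ‖f x‖ ^ 2) *
            (Real.sqrt b * Real.sqrt (∫ t in (0 : ℝ)..b, pathEnergyTot ω t))) := by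
        gcongr
        exact hback.trans hCS
    _ = _ := by ring

/-- **The pathwise coupling in Birkhoff form** (hypothesis `hcouple` of the a.e. Birkhoff–Chebyshev
selection): if a global Leray–Hopf solution `u` (datum `u 0`, steady smooth mean-zero force `f`,
`ν > 0`) realises the path `ω ∈ 𝒦 = pathSpace R L` after the shift `s ≥ 0`, i.e.
`𝓕(u t)(k) = ω̄(s + t, k)` for `t ≥ 0`, then there is a constant `c₀` (depending on the path, the
shift and the datum, not on `n`) with
`A_n F_d(ω) ≤ c₀/n + ‖f‖₂ (A_n F_e(ω))^{1/2}` for every `n ≥ 1` along the unit shift on `𝒦`. -/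
theorem stub_pathwiseCoupling (hν : 0 < ν) (hf : IsSmooth f) (hf0 : HasZeroMean f) {R : ℝ}
    {L : (Fin 3 → ℤ) → ℝ} (ω : ↥(pathSpace R L : Set (Path (Fin 3)))) {s : ℝ} (hs : 0 ≤ s)
    {u : ℝ → UnitAddTorus (Fin 3) → EuclideanSpace ℝ (Fin 3)}
    (hu : IsGlobalLerayHopf ν (fun _ => f) (u 0) u)
    (hcoef : ∀ t, 0 ≤ t → MemLp (u t) 2 volume ∧
      ∀ k, mFourierCoeff (EuclideanSpace.complexify ∘ u t) k = pathExt ω.1 (s + t) k)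
    (K : ℕ) :
    ∃ c₀ : ℝ, ∀ n : ℕ, 0 < n →
      birkhoffAverage ℝ (pathShiftOn R L (pathShift_mapsTo R L)) (fun x => dissMean ν K x.1) n ω ≤
        c₀ / n + Real.sqrt (∫ x, ‖f x‖ ^ 2) *
          Real.sqrt (birkhoffAverage ℝ (pathShiftOn R L (pathShift_mapsTo R L)) (fun x => energyMean x.1) n ω) := by
  -- adapted from MomentParityCoupling (`birkhoffAverage_dissMean_le_of_tendsto`)
  refine ⟨s * (ν * (4 * Real.pi ^ 2 * ((K : ℝ) ^ 2 * R ^ 2))) + kineticEnergy (u 0), fun n hn => ?_⟩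
  have h := intervalIntegral_pathDiss_le_pathwise hν hf hf0 ω.2 hs hu hcoef K (Nat.cast_nonneg n)
  rw [birkhoffAverage, birkhoffAverage, birkhoffSum_dissMean, birkhoffSum_energyMean]
  simp only [smul_eq_mul]
  have hnpos : (0 : ℝ) < n := by exact_mod_cast hn
  set c₀ := s * (ν * (4 * Real.pi ^ 2 * ((K : ℝ) ^ 2 * R ^ 2))) + kineticEnergy (u 0)
  set I := ∫ t in (0 : ℝ)..n, pathEnergyTot ω.1 t
  set J := ∫ t in (0 : ℝ)..n, pathDiss ν K ω.1 t
  set A' := Real.sqrt (∫ x, ‖f x‖ ^ 2)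
  have e : (n : ℝ)⁻¹ * (Real.sqrt n * Real.sqrt I) = Real.sqrt ((n : ℝ)⁻¹ * I) := by
    rw [← mul_assoc, inv_mul_eq_div, Real.sqrt_div_self, Real.sqrt_mul (inv_nonneg.2 hnpos.le),
      Real.sqrt_inv]
  calc (n : ℝ)⁻¹ * J ≤ (n : ℝ)⁻¹ * (c₀ + A' * (Real.sqrt n * Real.sqrt I)) :=
        mul_le_mul_of_nonneg_left h (inv_nonneg.2 hnpos.le)
    _ = c₀ / n + A' * ((n : ℝ)⁻¹ * (Real.sqrt n * Real.sqrt I)) := by ring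
    _ = c₀ / n + A' * Real.sqrt ((n : ℝ)⁻¹ * I) := by rw [e]

end Summit.AnomalousDissipation.AnomalousDissipation.Theorems.EnsembleRealization
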